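import Summits.ResolutionOfSingularities.ResolutionOfSingularities.Theorems.FrobeniusClosingPatchingRelPerfectConeDepthConeCharts
import HarnessLib

/-!
# Crux `PatchingRelPerfect` (stmt-ResolutionOfSingularities-16161), chain W5.2 — rung «r-cone-ℓ», local algebra IV: THE QUADRIC
# CONE OFF THE VERTEX — on every chart of `Bl_𝔪 Spec R` and at every prime over `𝔪` other than the vertex, exceptional divisor,
# old carrier `e₀ = c₀/c_i` and strict transform of the cone are simple normal crossings

[OURS · L1 W5.2 · rung tool] Replaces the role of NO printed item; NOT a statement of the manuscript under review; fact-free,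
any characteristic, any residue field.  AI-written (AI review is weaker than expert review).

The rung «r-cone-ℓ» (res-L1-w52-stub-4 g4, crux `PatchingRelPerfect` stmt-ResolutionOfSingularities-16161, line
`closed_point_slice`, open stub `stub_atomDimFourBlowup`): the member `I = (x₀x₁ + x₂²) + 𝔪^{ℓ+2}` — the quadric CONE at
exceptional depth `ℓ` — lies in the companion class for EVERY `ℓ ≥ 1`.  It is the minimal family with an `(ℓ, 2)`-DEFICIENT step
(CHAIN v2.1 kernel sentence (v″): the vertex of `V(q̄) ⊂ ℙ³` is an ordinary double point, of weight `2 < ℓ` for `ℓ ≥ 3`), resolved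
by `⌈ℓ/2⌉` blowings up of successive vertices (each reproducing the cone on the new exceptional carrier at depth `ℓ - 2`:
`u²·((y₀/u)(y₁/u) + (y₂/u)², u^{ℓ-2})`) followed by the two-monomial END game (`atomConclusion_of_pointwiseTwoMonomial`).

This file (continuing `…ConeDepthConeCharts`): at a prime `𝔓 ⊂ B_i` over `𝔪` and `L = (B_i)_𝔓`, the members of the list
`[c_i, e₀, coneFun]` (chart `i ≠ 0`: exceptional parameter, strict transform `e₀ = c₀/c_i` of the OLD carrier `V(c₀)`, strict
transform of the cone) resp. `[c₀, coneFun]` (chart `i = 0`, off the vertex) that lie in `𝔓` are, over `1`, members of ONE regular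
system of parameters of `L`, distinct members at distinct places:
* `coneChart_zero` — chart `i = 0` off the vertex (`T₁T₂ + T₃²` is regular off the origin: `∂/∂T₂ = T₁`, `∂/∂T₁ = T₂`);
* `coneChart_linear` (charts `i = 1, 2`, where `coneFun ≡ e_k + e₃²` is a graph, `∂/∂T_k = 1`; `mk_coneFun_one`, `mk_coneFun_two`);
* `coneChart_three` (chart `i = 3`, `coneFun ≡ e₁e₂ + 1`; `mk_coneFun_three`).
Consumer: the scheme-level vertex step of the rung (simple normal crossings of host, new carrier and old carrier at every point of
the blow-up over the vertex, except the new vertex).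

## References
* H. Matsumura, *Commutative Ring Theory*, CUP 1986, Thm. 14.2 (and the Remark after it), Thm. 17.4. [Matsumura1987]
* The Stacks Project, Tags 0804, 0BIQ (charts of a blowing up, `B_i/(c_i) ≅ (R/I)[T]`). [StacksProject]
* J. Kollár, *Lectures on Resolution of Singularities* (2007), Def. 3.24, (3.111) Step 3. [Kollar2007]
-/

-- `Summit.<Summit>.<Sub>.Theorems` with `Sub = Summit` (single-conjunct summit, D-0017)
set_option linter.dupNamespace false

noncomputable section

open IsLocalRing Literature.AlgebraicGeometry.Resolution
open scoped Pointwise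

namespace Summit.ResolutionOfSingularities.ResolutionOfSingularities.Theorems

universe u v w

namespace ConeDepth

section Cone

variable {R : Type u} [CommRing R] [IsRegularLocalRing R] (c : Fin 4 → R)
  (hz : Ideal.span (Set.range c) = maximalIdeal R) (hd : (maximalIdeal R).spanFinrank = 4) (i : Fin 4)

local notation3 "Bc" => chartRing c i
local notation3 "φc" => chartBase c i
local notation3 "ec[" j "]" => chartGen c i j


/-! ### Distinctness of the chart elements (read modulo the exceptional parameter) -/

omit [IsRegularLocalRing R] in
/-- `φ(c_i) ≡ 0` modulo the exceptional parameter. [folklore] -/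
theorem mk_chartBase_self : Ideal.Quotient.mk (Ideal.span {φc (c i)}) (φc (c i)) = 0 :=
  Ideal.Quotient.eq_zero_iff_mem.mpr (Ideal.mem_span_singleton_self _)

include hz hd in
/-- **`e₀ ≠ φ(c_i)` on a chart `i ≠ 0`** (`e₀ ↦ T₀ ≠ 0` modulo `c_i`). [folklore] -/
theorem chartGen_zero_ne_chartBase (hi : (0 : Fin 4) ≠ i) : ec[0] ≠ φc (c i) := by
  intro h
  have h1 := coneε_X c hz hd i ⟨0, hi⟩
  rw [h, mk_chartBase_self, map_eq_zero_iff _ (coneε c hz hd i).injective] at h1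
  exact MvPolynomial.X_ne_zero _ h1

include hz hd in
/-- **`coneFun ≠ φ(c_i)` and `coneFun ≠ e₀`** from a polynomial representative: if `coneε F = coneFun mod c_i` with `F ≠ 0` and
`F ≠ T₀`. [folklore] -/
theorem coneFun_ne_of_repr (F : MvPolynomial {j : Fin 4 // j ≠ i} (ResidueField R)) (hF0 : F ≠ 0)
    (hfF : coneε c hz hd i F = Ideal.Quotient.mk _ (coneFun c i)) :
    coneFun c i ≠ φc (c i) ∧ ∀ (hi : (0 : Fin 4) ≠ i), F ≠ MvPolynomial.X ⟨0, hi⟩ → coneFun c i ≠ ec[0] := by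
  constructor
  · intro h
    rw [h, mk_chartBase_self, map_eq_zero_iff _ (coneε c hz hd i).injective] at hfF
    exact hF0 hfF
  · intro hi hF h
    apply hF
    apply (coneε c hz hd i).injective
    rw [hfF, coneε_X, h]

/-! ### Chart `i = 0` off the vertex -/

section ChartZero

variable (𝔓 : Ideal (chartRing c 0)) [𝔓.IsPrime] (h𝔓 : 𝔓.comap (chartBase c 0) = maximalIdeal R)
  (L : Type u) [CommRing L] [IsLocalRing L] [Algebra (chartRing c 0) L] [IsLocalization.AtPrime L 𝔓]

include hz hd h𝔓 in
/-- **Chart `i = 0` (the chart of the carrier) OFF the vertex**: at a prime `𝔓` over `𝔪` not containing all of `e₁, e₂, e₃`,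
the members of `{c₀, f₀}` (`f₀ = e₁e₂ + e₃²`) lying in `𝔓` are part of ONE regular system of parameters of `L` — the exceptional
divisor and the strict transform of the cone are simple normal crossings there (Jacobian criterion on `κ[T₁, T₂, T₃]/(T₁T₂ + T₃²)`
off the vertex: `∂/∂T₂ = T₁`, `∂/∂T₁ = T₂`). [cite: Matsumura1987, Thm. 14.2] -/
theorem coneChart_zero (hnv : ¬ (chartGen c 0 1 ∈ 𝔓 ∧ chartGen c 0 2 ∈ 𝔓 ∧ chartGen c 0 3 ∈ 𝔓)) :
    ∃ (m : ℕ) (v : Fin m → L)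
      (ι : {g : chartRing c 0 // g ∈ [chartBase c 0 (c 0), coneFun c 0] ∧ g ∈ 𝔓} → Fin m),
      IsRsopPart v ∧ Function.Injective ι ∧ ∀ g, v (ι g) = (algebraMap (chartRing c 0) L : chartRing c 0 →+* L) g.1 := by
  classical
  by_cases hf : coneFun c 0 ∈ 𝔓
  · -- the polynomial representative `T₁T₂ + T₃²` (no killed generators)
    let σ := {j : {j : Fin 4 // j ≠ (0 : Fin 4)} // j ∉ {j : {j : Fin 4 // j ≠ (0 : Fin 4)} | j ∈ ([] : List _)}}
    let t1 : σ := ⟨⟨1, by decide⟩, by simp⟩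
    let t2 : σ := ⟨⟨2, by decide⟩, by simp⟩
    let t3 : σ := ⟨⟨3, by decide⟩, by simp⟩
    let F : MvPolynomial σ (ResidueField R) := MvPolynomial.X t1 * MvPolynomial.X t2 + MvPolynomial.X t3 ^ 2
    have hfF : coneε c hz hd 0 (MvPolynomial.rename Subtype.val F) = Ideal.Quotient.mk _ (coneFun c 0) := by
      simp only [F, map_add, map_mul, map_pow, MvPolynomial.rename_X, coneε_X, coneFun, t1, t2, t3]
    have hF0 : F ≠ 0 := by
      intro h
      have h' := congrArg (MvPolynomial.eval (fun j : σ => if j = t3 then (1 : ResidueField R) else 0)) h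
      have h23 : t2 ≠ t3 := by decide
      simp only [F, map_add, map_mul, map_pow, MvPolynomial.eval_X, if_neg h23, mul_zero, zero_add, if_true, one_pow,
        map_zero] at h'
      exact one_ne_zero h'
    -- `e₁ ∉ 𝔓` or `e₂ ∉ 𝔓` (else `e₃² = f₀ - e₁e₂ ∈ 𝔓` and `𝔓` is the vertex)
    have h12 : chartGen c 0 1 ∉ 𝔓 ∨ chartGen c 0 2 ∉ 𝔓 := by
      by_contra h
      simp only [not_or, not_not] at h
      apply hnv
      refine ⟨h.1, h.2, Ideal.IsPrime.mem_of_pow_mem inferInstance 2 ?_⟩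
      have heq : chartGen c 0 3 ^ 2 = coneFun c 0 - chartGen c 0 1 * chartGen c 0 2 := by rw [coneFun]; ring
      rw [heq]
      exact 𝔓.sub_mem hf (𝔓.mul_mem_right (chartGen c 0 2) h.1)
    rcases h12 with h1 | h2
    · have hGa : coneε c hz hd 0 (MvPolynomial.rename Subtype.val (MvPolynomial.pderiv t2 F)) =
          Ideal.Quotient.mk _ (chartGen c 0 1) := by
        have ht12 : t1 ≠ t2 := by decide
        have ht32 : t3 ≠ t2 := by decide
        simp only [F, map_add, Derivation.leibniz, Derivation.leibniz_pow, MvPolynomial.pderiv_X_self,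
          MvPolynomial.pderiv_X_of_ne ht12, MvPolynomial.pderiv_X_of_ne ht32, mul_zero, smul_zero, add_zero,
          smul_eq_mul, mul_one, MvPolynomial.rename_X, coneε_X, t1]
      have hrs := isRsopPart_cone_kill c hz hd 0 𝔓 h𝔓 L [] List.nodup_nil (by simp) hf F hF0 hfF t2 _ hGa h1
      exact rsopAdapted_of_consFamily_killFamily c 0 𝔓 L [] (coneFun c 0) hrs _ (fun g hg _ => by
        simp only [List.mem_cons, List.not_mem_nil, or_false] at hg
        rcases hg with rfl | rfl
        · exact Or.inl rfl
        · exact Or.inr (Or.inr rfl))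
    · have hGa : coneε c hz hd 0 (MvPolynomial.rename Subtype.val (MvPolynomial.pderiv t1 F)) =
          Ideal.Quotient.mk _ (chartGen c 0 2) := by
        have ht21 : t2 ≠ t1 := by decide
        have ht31 : t3 ≠ t1 := by decide
        simp only [F, map_add, Derivation.leibniz, Derivation.leibniz_pow, MvPolynomial.pderiv_X_self,
          MvPolynomial.pderiv_X_of_ne ht21, MvPolynomial.pderiv_X_of_ne ht31, mul_zero, smul_zero, add_zero,
          smul_eq_mul, mul_one, zero_add, MvPolynomial.rename_X, coneε_X, t2]
      have hrs := isRsopPart_cone_kill c hz hd 0 𝔓 h𝔓 L [] List.nodup_nil (by simp) hf F hF0 hfF t1 _ hGa h2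
      exact rsopAdapted_of_consFamily_killFamily c 0 𝔓 L [] (coneFun c 0) hrs _ (fun g hg _ => by
        simp only [List.mem_cons, List.not_mem_nil, or_false] at hg
        rcases hg with rfl | rfl
        · exact Or.inl rfl
        · exact Or.inr (Or.inr rfl))
  · -- `f₀ ∉ 𝔓`: only the exceptional parameter
    have hrs := isRsopPart_chartFamily_cone c hz hd 0 𝔓 h𝔓 L (a := 0) (fun k => k.elim0)
      (Function.injective_of_subsingleton _) (fun k => k.elim0)
    exact rsopAdapted_of_chartFamily c 0 𝔓 L _ hrs _ (fun g hg hgP => by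
      simp only [List.mem_cons, List.not_mem_nil, or_false] at hg
      rcases hg with rfl | rfl
      · exact Or.inl rfl
      · exact absurd hgP hf)

include hz hd in
/-- On chart `0`: `coneFun ≠ c₀` (`T₁T₂ + T₃² ≠ 0`). [folklore] -/
theorem coneFun_ne_chartBase_zero : coneFun c 0 ≠ chartBase c 0 (c 0) := by
  classical
  let F : MvPolynomial {j : Fin 4 // j ≠ (0 : Fin 4)} (ResidueField R) :=
    MvPolynomial.X ⟨1, by decide⟩ * MvPolynomial.X ⟨2, by decide⟩ + MvPolynomial.X ⟨3, by decide⟩ ^ 2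
  have hfF : coneε c hz hd 0 F = Ideal.Quotient.mk _ (coneFun c 0) := by
    simp only [F, map_add, map_mul, map_pow, coneε_X, coneFun]
  have hF0 : F ≠ 0 := by
    intro h
    have h23 : (⟨2, by decide⟩ : {j : Fin 4 // j ≠ (0 : Fin 4)}) ≠ ⟨3, by decide⟩ := by decide
    have h' := congrArg (MvPolynomial.eval (fun j : {j : Fin 4 // j ≠ (0 : Fin 4)} =>
      if j = ⟨3, by decide⟩ then (1 : ResidueField R) else 0)) h
    simp only [F, map_add, map_mul, map_pow, MvPolynomial.eval_X, if_neg h23, mul_zero, zero_add, if_true, one_pow,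
      map_zero] at h'
    exact one_ne_zero h'
  exact (coneFun_ne_of_repr c hz hd 0 F hF0 hfF).1

end ChartZero

/-! ### Charts `i = 1, 2`: the strict transform `e_k + e₃²` is a graph (`k` the other index in `{1, 2}`) -/

section ChartLinear

variable (𝔓 : Ideal (chartRing c i)) [𝔓.IsPrime] (h𝔓 : 𝔓.comap (chartBase c i) = maximalIdeal R)
  (L : Type u) [CommRing L] [IsLocalRing L] [Algebra (chartRing c i) L] [IsLocalization.AtPrime L 𝔓]

include hz hd h𝔓 in
/-- **Charts `i ∈ {1, 2}`**: with `k` the other index of `{1, 2}`, the cone reads `f_i = e_k + e₃²` (`e_i = 1`), a GRAPH over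
the remaining coordinates; at every prime `𝔓` over `𝔪` the members of `{c_i, e₀, f_i}` lying in `𝔓` (exceptional divisor, old
carrier, strict transform of the cone) are part of one regular system of parameters of `L` (`∂f/∂T_k = 1`).
[cite: Matsumura1987, Thm. 14.2] -/
theorem coneChart_linear (k : Fin 4) (hi0 : i ≠ 0) (hk0 : k ≠ 0) (hki : k ≠ i) (hk3 : k ≠ 3) (hi3 : (3 : Fin 4) ≠ i)
    (hcone : Ideal.Quotient.mk (Ideal.span {φc (c i)}) (coneFun c i) =
      Ideal.Quotient.mk (Ideal.span {φc (c i)}) ec[k] + Ideal.Quotient.mk (Ideal.span {φc (c i)}) ec[3] ^ 2) :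
    ∃ (m : ℕ) (v : Fin m → L)
      (ι : {g : chartRing c i // g ∈ [chartBase c i (c i), chartGen c i 0, coneFun c i] ∧ g ∈ 𝔓} → Fin m),
      IsRsopPart v ∧ Function.Injective ι ∧ ∀ g, v (ι g) = (algebraMap (chartRing c i) L : chartRing c i →+* L) g.1 := by
  classical
  have h1P : (1 : chartRing c i) ∉ 𝔓 := fun h => Ideal.IsPrime.ne_top inferInstance ((Ideal.eq_top_iff_one _).mpr h)
  by_cases hf : coneFun c i ∈ 𝔓
  · -- the kill family for a list `l ⊆ {0}` of killed generators
    have key : ∀ (l : List {j : Fin 4 // j ≠ i}), l.Nodup → (∀ j ∈ l, j.1 = 0) → (∀ j ∈ l, ec[j.1] ∈ 𝔓) →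
        IsRsopPart (consFamily c i L (chartBase c i) (killFamily i (chartGen c i) l (coneFun c i))) := by
      intro l hl hl0 hlu
      let σ := {j : {j : Fin 4 // j ≠ i} // j ∉ {j : {j : Fin 4 // j ≠ i} | j ∈ l}}
      let tk : σ := ⟨⟨k, hki⟩, fun h => hk0 (hl0 _ h)⟩
      let t3 : σ := ⟨⟨3, hi3⟩, fun h => by have h' := hl0 _ h; simp at h'⟩
      let F : MvPolynomial σ (ResidueField R) := MvPolynomial.X tk + MvPolynomial.X t3 ^ 2
      have hfF : coneε c hz hd i (MvPolynomial.rename Subtype.val F) = Ideal.Quotient.mk _ (coneFun c i) := by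
        simp only [F, map_add, map_pow, MvPolynomial.rename_X, coneε_X, hcone, tk, t3]
      have hk3' : tk ≠ t3 := fun h => hk3 (congrArg (fun t : σ => t.1.1) h)
      have hF0 : F ≠ 0 := by
        intro h
        have h' := congrArg (MvPolynomial.eval (fun j : σ => if j = tk then (1 : ResidueField R) else 0)) h
        simp only [F, map_add, map_pow, MvPolynomial.eval_X, if_true, if_neg hk3'.symm, map_zero, ne_eq,
          OfNat.ofNat_ne_zero, not_false_eq_true, zero_pow, add_zero] at h'
        exact one_ne_zero h'
      have hGa : coneε c hz hd i (MvPolynomial.rename Subtype.val (MvPolynomial.pderiv tk F)) =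
          Ideal.Quotient.mk _ 1 := by
        simp only [F, map_add, Derivation.leibniz_pow, MvPolynomial.pderiv_X_self, MvPolynomial.pderiv_X_of_ne hk3'.symm,
          smul_zero, add_zero, map_one]
      exact isRsopPart_cone_kill c hz hd i 𝔓 h𝔓 L l hl hlu hf F hF0 hfF tk 1 hGa h1P
    by_cases h0 : ec[0] ∈ 𝔓
    · have hrs := key [⟨0, hi0.symm⟩] (List.nodup_singleton _) (by simp) (by simpa using h0)
      exact rsopAdapted_of_consFamily_killFamily c i 𝔓 L _ (coneFun c i) hrs _ (fun g hg _ => by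
        simp only [List.mem_cons, List.not_mem_nil, or_false] at hg
        rcases hg with rfl | rfl | rfl
        · exact Or.inl rfl
        · exact Or.inr (Or.inl ⟨⟨0, hi0.symm⟩, List.mem_singleton_self _, rfl⟩)
        · exact Or.inr (Or.inr rfl))
    · have hrs := key [] List.nodup_nil (by simp) (by simp)
      exact rsopAdapted_of_consFamily_killFamily c i 𝔓 L _ (coneFun c i) hrs _ (fun g hg hgP => by
        simp only [List.mem_cons, List.not_mem_nil, or_false] at hg
        rcases hg with rfl | rfl | rfl
        · exact Or.inl rfl
        · exact absurd hgP h0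
        · exact Or.inr (Or.inr rfl))
  · by_cases h0 : ec[0] ∈ 𝔓
    · have hrs := isRsopPart_chartFamily_cone c hz hd i 𝔓 h𝔓 L (a := 1) (fun _ => ⟨0, hi0.symm⟩)
        (Function.injective_of_subsingleton _) (fun _ => h0)
      exact rsopAdapted_of_chartFamily c i 𝔓 L _ hrs _ (fun g hg hgP => by
        simp only [List.mem_cons, List.not_mem_nil, or_false] at hg
        rcases hg with rfl | rfl | rfl
        · exact Or.inl rfl
        · exact Or.inr ⟨0, rfl⟩
        · exact absurd hgP hf)
    · have hrs := isRsopPart_chartFamily_cone c hz hd i 𝔓 h𝔓 L (a := 0) (fun k => k.elim0)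
        (Function.injective_of_subsingleton _) (fun k => k.elim0)
      exact rsopAdapted_of_chartFamily c i 𝔓 L _ hrs _ (fun g hg hgP => by
        simp only [List.mem_cons, List.not_mem_nil, or_false] at hg
        rcases hg with rfl | rfl | rfl
        · exact Or.inl rfl
        · exact absurd hgP h0
        · exact absurd hgP hf)

omit [IsRegularLocalRing R] in
/-- On the chart `i = 1`: `f₁ ≡ e₂ + e₃²` (`e₁ = 1`; read modulo the exceptional parameter, where the generic ring lemmas
apply). [folklore] -/
theorem mk_coneFun_one : Ideal.Quotient.mk (Ideal.span {chartBase c 1 (c 1)}) (coneFun c 1) =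
    Ideal.Quotient.mk (Ideal.span {chartBase c 1 (c 1)}) (chartGen c 1 2) +
      Ideal.Quotient.mk (Ideal.span {chartBase c 1 (c 1)}) (chartGen c 1 3) ^ 2 := by
  have h1 : chartGen c 1 1 = 1 := chartGen_self c 1
  rw [coneFun, map_add, map_mul, map_pow, h1, map_one, one_mul]

omit [IsRegularLocalRing R] in
/-- On the chart `i = 2`: `f₂ ≡ e₁ + e₃²` (`e₂ = 1`). [folklore] -/
theorem mk_coneFun_two : Ideal.Quotient.mk (Ideal.span {chartBase c 2 (c 2)}) (coneFun c 2) =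
    Ideal.Quotient.mk (Ideal.span {chartBase c 2 (c 2)}) (chartGen c 2 1) +
      Ideal.Quotient.mk (Ideal.span {chartBase c 2 (c 2)}) (chartGen c 2 3) ^ 2 := by
  have h2 : chartGen c 2 2 = 1 := chartGen_self c 2
  rw [coneFun, map_add, map_mul, map_pow, h2, map_one, mul_one]

include hz hd in
/-- On charts `i ∈ {1, 2}`: `coneFun`, `e₀`, `c_i` are pairwise distinct (`T_k + T₃²`, `T₀`, `0` modulo `c_i`). [folklore] -/
theorem coneFun_ne_linear (k : Fin 4) (hi0 : (0 : Fin 4) ≠ i) (hki : k ≠ i) (hk3 : k ≠ 3) (hi3 : (3 : Fin 4) ≠ i) (hk0 : k ≠ 0)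
    (hcone : Ideal.Quotient.mk (Ideal.span {φc (c i)}) (coneFun c i) =
      Ideal.Quotient.mk (Ideal.span {φc (c i)}) ec[k] + Ideal.Quotient.mk (Ideal.span {φc (c i)}) ec[3] ^ 2) :
    coneFun c i ≠ φc (c i) ∧ coneFun c i ≠ ec[0] ∧ ec[0] ≠ φc (c i) := by
  classical
  let F : MvPolynomial {j : Fin 4 // j ≠ i} (ResidueField R) := MvPolynomial.X ⟨k, hki⟩ + MvPolynomial.X ⟨3, hi3⟩ ^ 2
  have hfF : coneε c hz hd i F = Ideal.Quotient.mk _ (coneFun c i) := by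
    simp only [F, map_add, map_pow, coneε_X, hcone]
  have hk3' : (⟨k, hki⟩ : {j : Fin 4 // j ≠ i}) ≠ ⟨3, hi3⟩ := fun h => hk3 (congrArg Subtype.val h)
  have hk0' : (⟨0, hi0⟩ : {j : Fin 4 // j ≠ i}) ≠ ⟨k, hki⟩ := fun h => hk0 (congrArg Subtype.val h).symm
  have hF0 : F ≠ 0 := by
    intro h
    have h' := congrArg (MvPolynomial.eval (fun j : {j : Fin 4 // j ≠ i} =>
      if j = ⟨k, hki⟩ then (1 : ResidueField R) else 0)) h
    simp only [F, map_add, map_pow, MvPolynomial.eval_X, if_true, if_neg hk3'.symm, map_zero, ne_eq,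
      OfNat.ofNat_ne_zero, not_false_eq_true, zero_pow, add_zero] at h'
    exact one_ne_zero h'
  have hFX : F ≠ MvPolynomial.X ⟨0, hi0⟩ := by
    intro h
    have h' := congrArg (MvPolynomial.eval (fun j : {j : Fin 4 // j ≠ i} =>
      if j = ⟨k, hki⟩ then (1 : ResidueField R) else 0)) h
    simp only [F, map_add, map_pow, MvPolynomial.eval_X, if_true, if_neg hk3'.symm, if_neg hk0', ne_eq,
      OfNat.ofNat_ne_zero, not_false_eq_true, zero_pow, add_zero] at h'
    exact one_ne_zero h'
  obtain ⟨h1, h2⟩ := coneFun_ne_of_repr c hz hd i F hF0 hfF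
  exact ⟨h1, h2 hi0 hFX, chartGen_zero_ne_chartBase c hz hd i hi0⟩

end ChartLinear


end Cone

end ConeDepth

end Summit.ResolutionOfSingularities.ResolutionOfSingularities.Theorems

end
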